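import Literature.Probability.Percolation.RingFeet
import Literature.Probability.Percolation.FiveArmPlainArms
import Literature.Probability.Percolation.FiveArmKissingCount
import HarnessLib

/-!
# The painted core: plain five arms in the arrangement `B W B W W` carry a kissing certificate

Topic `Literature/Probability/Percolation`; family `crit-perc` (site percolation on `𝕋`). PROOFS
(and the explicit gadget, as definitions; no named fact). The deterministic heart of the
finite-energy step of the separation-free proof of the five-arm upper bound `α₅ ≤ 2`
(P. Nolin, EJP 13 (2008), §4.1 finite energy and §5.2 Thm. 24, five-arm item; W. Werner, PCMI 2009,
First exercise sheet, "Five-arm exponent", 2)): for a landing tuple `s = (rp m i₀, …, rp m i₄)` on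
`∂Λ_m` in anticlockwise order `i₀ < i₁ < i₂ < i₃ < i₄ < i₀ + 6m` with colours `B, W, B, W, W`
(`plainArms`, `FiveArmPlainArms.lean`), an explicit PAINT of the core `Λ_m ∖ {s_j}` — a black run
on the ring `∂Λ_{m-1}` from the site `q` after the kissing site `x⋆` (the upper foot of the bond
`(s₀, s₀⁺)`) to a foot of `s₂`, everything else white — makes every configuration of
`plainArms κ_E s m n ∩ paint core blackRun` satisfy the kissing certificate `kissCert x⋆ R` of
`FiveArmKissingCount.lean` (`m + 1 ≤ R`, `R + 1 ≤ n`): `x⋆` is white, its black neighbours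
`s₀` and `q` are joined to `∂Λ_R` by black paths (the arm of `s₀`; the black run, `s₂` and its arm),
and three white neighbours `s₀⁺`, `p = x⋆⁻`, `r` (the lower inner foot of `x⋆`) are joined to
`∂Λ_{R+1}` inside pairwise disjoint white sets (the ring `∂Λ_m` up to `s₁` and the arm of `s₁`;
`s₀⁻`, the ring `∂Λ_m` backwards to `s₄` and its arm; a step on `∂Λ_{m-2}`, the ring `∂Λ_{m-1}`
backwards to a foot of `s₃`, and its arm), the first and the second in opposite fans of the
transit `(s₀, x⋆, q)` (`fan_of_chain2/3`: the directions of `s₀, s₀⁺, (s₀⁺⁺,) q` at `x⋆` are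
consecutive).

* `GadgetIdx m i` — the hypotheses on the indices (`m ≥ 4`, `6m ≤ i₀`, the cyclic order);
* `xs, q, p, r, fB, fW, blackRun, …` — the gadget; `fB_lt_fW` etc. — its index arithmetic
  (`RingFeet.lean`);
* `plainArms_inter_paint_subset_kissCert` — **the inclusion**.

## References

* P. Nolin, Near-critical percolation in two dimensions, *Electron. J. Probab.* 13 (2008)
  1562–1623, §4.1 and §5.2 Thm. 24 (arXiv 0711.4948: §4.1, Thm. 23 (iii)) [Nolin2008].
* W. Werner, *Lectures on two-dimensional critical percolation*, IAS/Park City Math. Ser. 16 (2009),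
  First exercise sheet, "Five-arm exponent", 2) (arXiv 0710.0856) [WernerPCMI2009].

## Mathlib / tree

Tree: `footIdx`, `rp_adj_rp_footIdx(_pred)`, `footIdx_*`, `pathIn_rp_run(')` (`RingFeet.lean`);
`rp`, `rp_adj`, `rp_ne_rp_of_lt`, `triNorm_rp`, `rp_add_period` (`RingArcs.lean`); `plainArms`,
`paint`, `coreOf` (`FiveArmPlainArms.lean`); `kissCert` (`FiveArmKissingCount.lean`);
`triGraph_adj_iff_coord` (`TriAnnulusCircuit.lean`); `dirOf`, `eq_add_triDir_dirOf`,
`dirOf_add_triDir` (`TriDiscShelling.lean`); `PathIn.exit` (`SitePaths.lean`).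
-/

noncomputable section

open Set

namespace Literature.Probability.Percolation

open LatticeModels

/-! ### Directions at a site: consecutive neighbours and fans -/

/-- **Two neighbours of a site are adjacent iff their directions are consecutive.** [folklore] -/
theorem adj_add_triDir_iff (x : Site 2) (i j : Fin 6) :
    triGraph.Adj (x + triDir i) (x + triDir j) ↔ (j = i + 1 ∨ i = j + 1) := by
  rw [triGraph_adj_iff_coord]
  fin_cases i <;> fin_cases j <;> simp [triDir, Pi.add_apply] <;> omega

/-- **Fan lemma, short chain.** If the directions `o, k₀, d` are consecutive steps (`d ≠ o`) and
`k₁` is a fourth direction, then `k₀` and `k₁` lie in opposite fans of the transit `(o, d)`. [folklore] -/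
theorem fan_of_chain2 : ∀ o k0 d k1 : Fin 6, (k0 = o + 1 ∨ o = k0 + 1) → (d = k0 + 1 ∨ k0 = d + 1) → d ≠ o →
    k1 ≠ o → k1 ≠ k0 → k1 ≠ d →
    (((k0 - o : Fin 6) : ℕ) < ((d - o : Fin 6) : ℕ) ∧ ((d - o : Fin 6) : ℕ) < ((k1 - o : Fin 6) : ℕ)) ∨
    (((k1 - o : Fin 6) : ℕ) < ((d - o : Fin 6) : ℕ) ∧ ((d - o : Fin 6) : ℕ) < ((k0 - o : Fin 6) : ℕ)) := by
  decide

/-- **Fan lemma, long chain.** If `o, k₀, c, d` are consecutive steps through pairwise distinct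
directions and `k₁` is a fifth direction, then `k₀` and `k₁` lie in opposite fans of `(o, d)`. [folklore] -/
theorem fan_of_chain3 : ∀ o k0 c d k1 : Fin 6, (k0 = o + 1 ∨ o = k0 + 1) → (c = k0 + 1 ∨ k0 = c + 1) →
    (d = c + 1 ∨ c = d + 1) → c ≠ o → d ≠ k0 → d ≠ o → k1 ≠ o → k1 ≠ k0 → k1 ≠ c → k1 ≠ d →
    (((k0 - o : Fin 6) : ℕ) < ((d - o : Fin 6) : ℕ) ∧ ((d - o : Fin 6) : ℕ) < ((k1 - o : Fin 6) : ℕ)) ∨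
    (((k1 - o : Fin 6) : ℕ) < ((d - o : Fin 6) : ℕ) ∧ ((d - o : Fin 6) : ℕ) < ((k0 - o : Fin 6) : ℕ)) := by
  decide

/-- Directions of distinct neighbours are distinct. [folklore] -/
theorem dirOf_ne_of_ne {x u v : Site 2} (hu : triGraph.Adj x u) (hv : triGraph.Adj x v) (h : u ≠ v) : dirOf x u ≠ dirOf x v := by
  intro e
  exact h (by rw [eq_add_triDir_dirOf hu, eq_add_triDir_dirOf hv, e])

/-- Adjacent neighbours have consecutive directions. [folklore] -/
theorem dirOf_step {x u v : Site 2} (hu : triGraph.Adj x u) (hv : triGraph.Adj x v) (h : triGraph.Adj u v) :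
    dirOf x v = dirOf x u + 1 ∨ dirOf x u = dirOf x v + 1 := by
  rw [eq_add_triDir_dirOf hu, eq_add_triDir_dirOf hv] at h
  exact (adj_add_triDir_iff x _ _).1 h

/-! ### The indices of the gadget -/

namespace Gadget

/-- **The hypotheses on the core radius and the landing indices**: `m ≥ 4`, the indices read
anticlockwise `i₀ < i₁ < i₂ < i₃ < i₄ < i₀ + 6m`, and `i₀ ≥ 6m` (room for index subtractions;
`rp` has period `6m`). [folklore] -/
structure GadgetIdx (m : ℕ) (i : Fin 5 → ℕ) : Prop where
  four_le : 4 ≤ m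
  base : 6 * m ≤ i 0
  lt01 : i 0 < i 1
  lt12 : i 1 < i 2
  lt23 : i 2 < i 3
  lt34 : i 3 < i 4
  lt40 : i 4 < i 0 + 6 * m

variable (m : ℕ) (i : Fin 5 → ℕ)

/-- The landing tuple. [folklore] -/
def sOf : Fin 5 → Site 2 := fun j => rp m (i j)

/-- The colours `B, W, B, W, W`. [folklore] -/
def κE : Fin 5 → Bool := ![true, false, true, false, false]

/-- Index of the kissing site `x⋆` on `∂Λ_{m-1}`: the upper foot of `s₀`. [folklore] -/
def X : ℕ := footIdx m (i 0)

/-- The index window's upper end on `∂Λ_{m-1}` for the white run (two before `x⋆`, one turn later). [folklore] -/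
def ub : ℕ := X m i + 6 * (m - 1) - 2

/-- The foot of `s₂` at which the black run ends. [folklore] -/
def fB : ℕ := if X m i < footIdx m (i 2 - 1) then footIdx m (i 2 - 1) else footIdx m (i 2)

/-- The foot of `s₃` at which the white run ends. [folklore] -/
def fW : ℕ := if footIdx m (i 3) ≤ ub m i then footIdx m (i 3) else footIdx m (i 3 - 1)

/-- The kissing site. [folklore] -/
def xs : Site 2 := rp (m - 1) (X m i)

/-- The black neighbour `q = x⋆⁺` on `∂Λ_{m-1}`. [folklore] -/
def q : Site 2 := rp (m - 1) (X m i + 1)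

/-- The white neighbour `p = x⋆⁻` on `∂Λ_{m-1}`. [folklore] -/
def p : Site 2 := rp (m - 1) (X m i + 6 * (m - 1) - 1)

/-- The white neighbour `r` on `∂Λ_{m-2}`: the lower inner foot of `x⋆`. [folklore] -/
def r : Site 2 := rp (m - 2) (footIdx (m - 1) (X m i + 6 * (m - 1) - 1))

/-- The second site of the white escape through `r`: the upper inner foot of `x⋆⁻⁻`. [folklore] -/
def r₂ : Site 2 := rp (m - 2) (footIdx (m - 1) (X m i + 6 * (m - 1) - 2))

/-- The black run on `∂Λ_{m-1}` (the paint). [folklore] -/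
def blackRun : Set (Site 2) := {v | ∃ j, X m i + 1 ≤ j ∧ j ≤ fB m i ∧ v = rp (m - 1) j}

/-- The white run on `∂Λ_{m-1}`. [folklore] -/
def whiteRun : Set (Site 2) := {v | ∃ j, fW m i ≤ j ∧ j ≤ ub m i ∧ v = rp (m - 1) j}

/-- The white arc of `∂Λ_m` from `s₀⁺` up to (excluding) `s₁`. [folklore] -/
def aArc : Set (Site 2) := {v | ∃ j, i 0 < j ∧ j < i 1 ∧ v = rp m j}

/-- The white arc of `∂Λ_m` after `s₄` up to (excluding) `s₀`, one turn later. [folklore] -/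
def bArc : Set (Site 2) := {v | ∃ j, i 4 < j ∧ j < i 0 + 6 * m ∧ v = rp m j}

variable {m i}

/-! ### Index arithmetic -/

section Idx

variable (h : GadgetIdx m i)
include h

/-- `1 ≤ m`. [folklore] -/
theorem GadgetIdx.one_le : 1 ≤ m := by have := h.four_le; omega
/-- `1 ≤ m - 1`. [folklore] -/
theorem GadgetIdx.one_le' : 1 ≤ m - 1 := by have := h.four_le; omega
/-- `2 ≤ m - 1`. [folklore] -/
theorem GadgetIdx.two_le' : 2 ≤ m - 1 := by have := h.four_le; omega
/-- `1 ≤ m - 2`. [folklore] -/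
theorem GadgetIdx.one_le'' : 1 ≤ m - 2 := by have := h.four_le; omega

/-- The foot index one turn later. [folklore] -/
theorem GadgetIdx.footIdx_turn : footIdx m (i 0 + 6 * m) = X m i + 6 * (m - 1) := footIdx_add_period h.one_le _

/-- `X + 1 ≤ fB`. [folklore] -/
theorem GadgetIdx.X_lt_fB : X m i + 1 ≤ fB m i := by
  have h01 := h.lt01; have h12 := h.lt12
  unfold fB X
  split_ifs with hlt
  · omega
  · have h1 := footIdx_add_two (show 2 ≤ m by have := h.four_le; omega) (i 0)
    have h2 := footIdx_mono m (show i 0 + 2 ≤ i 2 by omega)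
    omega

/-- `fB` is a foot of `s₂`. [folklore] -/
theorem GadgetIdx.adj_s2_fB : triGraph.Adj (rp m (i 2)) (rp (m - 1) (fB m i)) := by
  unfold fB
  split_ifs
  · exact rp_adj_rp_footIdx_pred (show 2 ≤ m by have := h.four_le; omega) (by have := h.lt12; omega)
  · exact rp_adj_rp_footIdx (show 2 ≤ m by have := h.four_le; omega) _

/-- `fW ≤ ub`. [folklore] -/
theorem GadgetIdx.fW_le_ub : fW m i ≤ ub m i := by
  have hm := h.four_le; have hbase := h.base
  have hturn := h.footIdx_turn
  unfold X at hturn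
  unfold fW ub X
  split_ifs with hle
  · exact hle
  · -- `i₃ - 1 ≤ i₀ + 6m - 3`, and three steps advance by at least two
    have h1 : i 3 - 1 ≤ i 0 + 6 * m - 3 := by have := h.lt34; have := h.lt40; omega
    have h2 := footIdx_mono m h1
    have h3 := footIdx_add_ge (k := m) (j := i 0 + 6 * m - 3) (d := 3) h.one_le (by omega)
    rw [show i 0 + 6 * m - 3 + 3 = i 0 + 6 * m by omega] at h3
    omega

/-- `fW` is a foot of `s₃`. [folklore] -/
theorem GadgetIdx.adj_s3_fW : triGraph.Adj (rp m (i 3)) (rp (m - 1) (fW m i)) := by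
  unfold fW
  split_ifs
  · exact rp_adj_rp_footIdx (show 2 ≤ m by have := h.four_le; omega) _
  · exact rp_adj_rp_footIdx_pred (show 2 ≤ m by have := h.four_le; omega) (by have := h.lt23; omega)

/-- In the case `footIdx (i₂ - 1) ≤ X` the second landing site is `i₀ + 2`, hence `i₂ ≤ i₀ + 3` in general
terms: `footIdx (i₂ - 1) ≤ footIdx i₀ → i₂ ≤ i₀ + 3` fails, but `i₂ - 1 ≤ i₀ + 2` holds. [folklore] -/
theorem GadgetIdx.i2_le_of_le (hle : footIdx m (i 2 - 1) ≤ footIdx m (i 0)) : i 2 - 1 ≤ i 0 + 2 := by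
  have h01 := h.lt01; have h12 := h.lt12
  by_contra hgt
  have e1 := footIdx_mono m (show i 0 ≤ i 0 + 1 by omega)
  have e2 := footIdx_add_two (show 2 ≤ m by have := h.four_le; omega) (i 0 + 1)
  rw [show i 0 + 1 + 2 = i 0 + 3 by omega] at e2
  have e3 := footIdx_mono m (show i 0 + 3 ≤ i 2 - 1 by omega)
  omega

/-- **The black run ends before the white run starts**: `fB < fW`. [folklore] -/
theorem GadgetIdx.fB_lt_fW : fB m i < fW m i := by
  have hm := h.four_le; have hbase := h.base
  have h01 := h.lt01; have h12 := h.lt12; have h23 := h.lt23; have h34 := h.lt34; have h40 := h.lt40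
  have hturn := h.footIdx_turn
  unfold X at hturn
  have hi2le := h.i2_le_of_le
  unfold fB fW ub X
  -- generic facts
  have M23 := footIdx_mono m (show i 2 ≤ i 3 by omega)
  by_cases hA : footIdx m (i 3) ≤ footIdx m (i 0) + 6 * (m - 1) - 2
  · rw [if_pos hA]
    by_cases hB : footIdx m (i 0) < footIdx m (i 2 - 1)
    · rw [if_pos hB]
      have e1 := footIdx_add_two (show 2 ≤ m by have := h.four_le; omega) (i 2 - 1)
      rw [show i 2 - 1 + 2 = i 2 + 1 by omega] at e1
      have e2 := footIdx_mono m (show i 2 + 1 ≤ i 3 by omega)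
      omega
    · rw [if_neg hB]
      push Not at hB
      have hi2 := hi2le hB
      -- `F(i₂) = F(i₃)` would need a stall at `i₂` right after the stall at `i₀`
      rcases Nat.eq_or_lt_of_le M23 with heq | hlt
      · exfalso
        have e1 := footIdx_add_two (show 2 ≤ m by have := h.four_le; omega) (i 2)
        have hi3 : i 3 = i 2 + 1 := by
          by_contra hne
          have e2 := footIdx_mono m (show i 2 + 2 ≤ i 3 by omega)
          omega
        have e3 := footIdx_mono m (show i 0 ≤ i 0 + 1 by omega)
        have e4 := footIdx_mono m (show i 0 + 1 ≤ i 2 - 1 by omega)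
        have stall0 : footIdx m (i 0 + 1) = footIdx m (i 0) := by omega
        have stall2 : footIdx m (i 2 + 1) = footIdx m (i 2) := by rw [← hi3]; exact heq.symm
        have := footIdx_add_le_of_stall stall0 stall2 (by omega)
        omega
      · exact hlt
  · rw [if_neg hA]
    push Not at hA
    -- `F(i₃) ≥ F(i₀) + 6(m-1) - 1` forces `i₃ = i₀ + 6m - 2`
    have M3 := footIdx_mono m (show i 3 ≤ i 0 + 6 * m - 2 by omega)
    have hi3 : i 3 = i 0 + 6 * m - 2 := by
      by_contra hne
      have e2 := footIdx_mono m (show i 3 + 3 ≤ i 0 + 6 * m by omega)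
      have e3 := footIdx_add_ge (k := m) (j := i 3) (d := 3) h.one_le (by omega)
      omega
    have hF3 : footIdx m (i 3) = footIdx m (i 0 + 6 * m - 2) := by rw [hi3]
    have hF3m : footIdx m (i 3 - 1) = footIdx m (i 0 + 6 * m - 3) := by rw [hi3, show i 0 + 6 * m - 2 - 1 = i 0 + 6 * m - 3 by omega]
    -- steps near the end of the turn
    have S2 := footIdx_succ_le m (i 0 + 6 * m - 2)
    rw [show i 0 + 6 * m - 2 + 1 = i 0 + 6 * m - 1 by omega] at S2
    have S1 := footIdx_succ_le m (i 0 + 6 * m - 1)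
    rw [show i 0 + 6 * m - 1 + 1 = i 0 + 6 * m by omega] at S1
    have M2 := footIdx_mono m (show i 0 + 6 * m - 2 ≤ i 0 + 6 * m - 1 by omega)
    have M1 := footIdx_mono m (show i 0 + 6 * m - 1 ≤ i 0 + 6 * m by omega)
    have S3 := footIdx_succ_le m (i 0 + 6 * m - 3)
    rw [show i 0 + 6 * m - 3 + 1 = i 0 + 6 * m - 2 by omega] at S3
    have M3' := footIdx_mono m (show i 0 + 6 * m - 3 ≤ i 0 + 6 * m - 2 by omega)
    have S4 := footIdx_succ_le m (i 0 + 6 * m - 4)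
    rw [show i 0 + 6 * m - 4 + 1 = i 0 + 6 * m - 3 by omega] at S4
    have M4 := footIdx_mono m (show i 0 + 6 * m - 4 ≤ i 0 + 6 * m - 3 by omega)
    -- a stall occurs among the last two steps; hence none at the two steps before
    have last : footIdx m (i 0 + 6 * m - 2 + 1) = footIdx m (i 0 + 6 * m - 2) ∨
        footIdx m (i 0 + 6 * m - 1 + 1) = footIdx m (i 0 + 6 * m - 1) := by
      rw [show i 0 + 6 * m - 2 + 1 = i 0 + 6 * m - 1 by omega, show i 0 + 6 * m - 1 + 1 = i 0 + 6 * m by omega]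
      omega
    have no3 : footIdx m (i 0 + 6 * m - 2) = footIdx m (i 0 + 6 * m - 3) + 1 := by
      by_contra hne
      have hs : footIdx m (i 0 + 6 * m - 3 + 1) = footIdx m (i 0 + 6 * m - 3) := by
        rw [show i 0 + 6 * m - 3 + 1 = i 0 + 6 * m - 2 by omega]; omega
      rcases last with hs' | hs'
      · have := footIdx_add_le_of_stall hs hs' (by omega); omega
      · have := footIdx_add_le_of_stall hs hs' (by omega); omega
    have no4 : footIdx m (i 0 + 6 * m - 3) = footIdx m (i 0 + 6 * m - 4) + 1 := by
      by_contra hne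
      have hs : footIdx m (i 0 + 6 * m - 4 + 1) = footIdx m (i 0 + 6 * m - 4) := by
        rw [show i 0 + 6 * m - 4 + 1 = i 0 + 6 * m - 3 by omega]; omega
      rcases last with hs' | hs'
      · have := footIdx_add_le_of_stall hs hs' (by omega); omega
      · have := footIdx_add_le_of_stall hs hs' (by omega); omega
    rw [hF3m]
    by_cases hB : footIdx m (i 0) < footIdx m (i 2 - 1)
    · rw [if_pos hB]
      have e6 := footIdx_mono m (show i 2 - 1 ≤ i 0 + 6 * m - 4 by omega)
      omega
    · rw [if_neg hB]
      push Not at hB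
      have hi2 := hi2le hB
      have e6 := footIdx_mono m (show i 2 ≤ i 0 + 6 * m - 4 by omega)
      omega

/-- `ub + 2 = X + 6(m-1)`. [folklore] -/
theorem GadgetIdx.ub_add_two : ub m i + 2 = X m i + 6 * (m - 1) := by unfold ub; have := h.four_le; omega

end Idx

/-! ### Adjacencies and distinctness -/

/-- `x⋆` one turn later. [folklore] -/
theorem xs_eq_turn : xs m i = rp (m - 1) (X m i + 6 * (m - 1)) := (rp_add_period _ _).symm

/-- `m - 1 - 1 = m - 2`. [folklore] -/
theorem sub_one_sub_one (m : ℕ) : m - 1 - 1 = m - 2 := by omega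

section Adj

variable (h : GadgetIdx m i)
include h

/-- `s₀ ∼ x⋆`. [folklore] -/
theorem GadgetIdx.adj_b_xs : triGraph.Adj (rp m (i 0)) (xs m i) := rp_adj_rp_footIdx (show 2 ≤ m by have := h.four_le; omega) _

/-- `s₀⁺ ∼ x⋆`. [folklore] -/
theorem GadgetIdx.adj_bp_xs : triGraph.Adj (rp m (i 0 + 1)) (xs m i) := by
  have := rp_adj_rp_footIdx_pred (show 2 ≤ m by have := h.four_le; omega) (j := i 0 + 1) (by omega)
  rwa [Nat.add_sub_cancel] at this

/-- `s₀ ∼ s₀⁺`. [folklore] -/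
theorem GadgetIdx.adj_b_bp : triGraph.Adj (rp m (i 0)) (rp m (i 0 + 1)) := rp_adj h.one_le _

/-- `x⋆ ∼ q`. [folklore] -/
theorem GadgetIdx.adj_xs_q : triGraph.Adj (xs m i) (q m i) := rp_adj h.one_le' _

/-- `p ∼ x⋆`. [folklore] -/
theorem GadgetIdx.adj_p_xs : triGraph.Adj (p m i) (xs m i) := by
  have := rp_adj h.one_le' (X m i + 6 * (m - 1) - 1)
  rwa [show X m i + 6 * (m - 1) - 1 + 1 = X m i + 6 * (m - 1) by have := h.four_le; omega, ← xs_eq_turn] at this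

/-- `x⋆ ∼ r`. [folklore] -/
theorem GadgetIdx.adj_xs_r : triGraph.Adj (xs m i) (r m i) := by
  have := rp_adj_rp_footIdx_pred h.two_le' (j := X m i + 6 * (m - 1)) (by have := h.four_le; omega)
  rwa [← xs_eq_turn, sub_one_sub_one] at this

/-- `r₂ ∼ e` where `e = rp (m-1) ub` is the start of the white run. [folklore] -/
theorem GadgetIdx.adj_e_r₂ : triGraph.Adj (rp (m - 1) (ub m i)) (r₂ m i) := by
  have := rp_adj_rp_footIdx h.two_le' (X m i + 6 * (m - 1) - 2)
  rw [sub_one_sub_one] at this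
  exact this

/-- `r = r₂` or `r ∼ r₂`. [folklore] -/
theorem GadgetIdx.r_eq_or_adj : r m i = r₂ m i ∨ triGraph.Adj (r m i) (r₂ m i) := by
  unfold r r₂
  have hle := footIdx_pred_le (k := m - 1) (j := X m i + 6 * (m - 1) - 1) (by have := h.four_le; omega)
  rw [show X m i + 6 * (m - 1) - 1 - 1 = X m i + 6 * (m - 1) - 2 by omega] at hle
  rcases Nat.eq_or_lt_of_le hle.1 with he | hlt
  · left; rw [he]
  · right
    have : footIdx (m - 1) (X m i + 6 * (m - 1) - 1) = footIdx (m - 1) (X m i + 6 * (m - 1) - 2) + 1 := by omega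
    rw [this]
    exact rp_adj' h.one_le'' _

/-- `p ∼ s₀⁻`. [folklore] -/
theorem GadgetIdx.adj_bm_p : triGraph.Adj (rp m (i 0 + 6 * m - 1)) (p m i) := by
  have hm := h.four_le
  have hturn := h.footIdx_turn
  have hstep := footIdx_succ_le m (i 0 + 6 * m - 1)
  have hmono := footIdx_mono m (show i 0 + 6 * m - 1 ≤ i 0 + 6 * m by omega)
  rw [show i 0 + 6 * m - 1 + 1 = i 0 + 6 * m by omega] at hstep
  by_cases hc : footIdx m (i 0 + 6 * m - 1) = X m i + 6 * (m - 1) - 1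
  · have := rp_adj_rp_footIdx (show 2 ≤ m by have := h.four_le; omega) (i 0 + 6 * m - 1)
    rwa [hc] at this
  · -- a stall at the last step: the lower foot is `p`
    have heq : footIdx m (i 0 + 6 * m - 1) = footIdx m (i 0 + 6 * m) := by omega
    have hstall : footIdx m (i 0 + 6 * m - 1 + 1) = footIdx m (i 0 + 6 * m - 1) := by
      rw [show i 0 + 6 * m - 1 + 1 = i 0 + 6 * m by omega]; exact heq.symm
    have hno : footIdx m (i 0 + 6 * m - 2 + 1) ≠ footIdx m (i 0 + 6 * m - 2) := by
      intro hs
      have := footIdx_add_le_of_stall hs hstall (by omega)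
      omega
    have hstep' := footIdx_succ_le m (i 0 + 6 * m - 2)
    have hmono' := footIdx_mono m (show i 0 + 6 * m - 2 ≤ i 0 + 6 * m - 2 + 1 by omega)
    rw [show i 0 + 6 * m - 2 + 1 = i 0 + 6 * m - 1 by omega] at hstep' hmono' hno
    have hc' : footIdx m (i 0 + 6 * m - 1 - 1) = X m i + 6 * (m - 1) - 1 := by
      rw [show i 0 + 6 * m - 1 - 1 = i 0 + 6 * m - 2 by omega]; omega
    have := rp_adj_rp_footIdx_pred (show 2 ≤ m by have := h.four_le; omega) (j := i 0 + 6 * m - 1) (by omega)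
    rwa [hc'] at this

/-- `q ∼ s₀⁺` off the corner case. [folklore] -/
theorem GadgetIdx.adj_bp_q (hnd : ¬ m ∣ i 0 + 1) : triGraph.Adj (rp m (i 0 + 1)) (q m i) := by
  have := rp_adj_rp_footIdx (show 2 ≤ m by have := h.four_le; omega) (i 0 + 1)
  rwa [footIdx_succ_eq_of_not_dvd hnd] at this

/-- The corner case `m ∣ i₀ + 1`: `s₀⁺⁺ ∼ x⋆`. [folklore] -/
theorem GadgetIdx.adj_bpp_xs (hd : m ∣ i 0 + 1) : triGraph.Adj (rp m (i 0 + 2)) (xs m i) := by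
  have := rp_adj_rp_footIdx_pred (show 2 ≤ m by have := h.four_le; omega) (j := i 0 + 2) (by omega)
  rwa [show i 0 + 2 - 1 = i 0 + 1 by omega, footIdx_succ_eq_iff.2 hd] at this

/-- The corner case: `s₀⁺⁺ ∼ q`. [folklore] -/
theorem GadgetIdx.adj_bpp_q (hd : m ∣ i 0 + 1) : triGraph.Adj (rp m (i 0 + 2)) (q m i) := by
  have hnd : ¬ m ∣ i 0 + 1 + 1 := by
    intro h2
    have := Nat.dvd_sub h2 hd
    rw [Nat.add_sub_cancel_left] at this
    have := Nat.le_of_dvd one_pos this; have := h.four_le; omega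
  have := rp_adj_rp_footIdx (show 2 ≤ m by have := h.four_le; omega) (i 0 + 2)
  rwa [show i 0 + 2 = i 0 + 1 + 1 by omega, footIdx_succ_eq_of_not_dvd hnd, footIdx_succ_eq_iff.2 hd] at this

/-- Norms of the gadget sites. [folklore] -/
theorem GadgetIdx.triNorm_rp_m (j : ℕ) : triNorm (rp m j) = m := triNorm_rp h.one_le j

/-- Norm of the sites of `∂Λ_{m-1}`. [folklore] -/
theorem GadgetIdx.triNorm_rp_m1 (j : ℕ) : triNorm (rp (m - 1) j) = (m : ℤ) - 1 := by
  rw [triNorm_rp h.one_le']; have := h.four_le; omega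

/-- Norm of the sites of `∂Λ_{m-2}`. [folklore] -/
theorem GadgetIdx.triNorm_rp_m2 (j : ℕ) : triNorm (rp (m - 2) j) = (m : ℤ) - 2 := by
  rw [triNorm_rp h.one_le'']; have := h.four_le; omega

/-- Distinct ring indices within one turn of `i₀` give distinct sites of `∂Λ_m`. [folklore] -/
theorem GadgetIdx.rp_m_ne {a b : ℕ} (ha : i 0 ≤ a) (hab : a < b) (hb : b < i 0 + 6 * m) : rp m a ≠ rp m b :=
  rp_ne_rp_of_lt h.one_le hab (by omega)

/-- Distinct ring indices within one turn of `X` give distinct sites of `∂Λ_{m-1}`. [folklore] -/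
theorem GadgetIdx.rp_m1_ne {a b : ℕ} (ha : X m i ≤ a) (hab : a < b) (hb : b < X m i + 6 * (m - 1)) : rp (m - 1) a ≠ rp (m - 1) b :=
  rp_ne_rp_of_lt h.one_le' hab (by omega)

/-- The landing sites are `rp m (i j)` with `i₀ ≤ i j < i₀ + 6m`. [folklore] -/
theorem GadgetIdx.i_bounds (j : Fin 5) : i 0 ≤ i j ∧ i j < i 0 + 6 * m := by
  have := h.lt01; have := h.lt12; have := h.lt23; have := h.lt34; have := h.lt40
  fin_cases j <;> simp <;> omega

end Adj

/-! ### Truncating a path at a norm -/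

/-- **First arrival at a norm level**: a lattice path inside `S` from a site of norm `< R` to a
site of norm `≥ R` contains a path inside `S ∩ Λ_R` from its start to a site of norm `R`. [folklore] -/
theorem exists_pathIn_trunc {S : Set (Site 2)} {a z : Site 2} {R : ℕ} (hp : PathIn triGraph S a z)
    (ha : triNorm a < R) (hz : (R : ℤ) ≤ triNorm z) :
    ∃ t, triNorm t = R ∧ PathIn triGraph (S ∩ {v | triNorm v ≤ R}) a t := by
  obtain ⟨c, d, hc, hd, hdS, hcd, hq⟩ := hp.exit (R := {v | triNorm v < R}) ha (by change ¬ triNorm z < R; omega)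
  change triNorm c < R at hc
  change ¬ triNorm d < R at hd
  have h1 := triNorm_le_triNorm_add_one_of_adj hcd
  refine ⟨d, by omega, (hq.mono ?_).tail hcd ⟨hdS, by change triNorm d ≤ R; omega⟩⟩
  rintro v ⟨hv1, hv2⟩
  exact ⟨hv2, show triNorm v ≤ R from le_of_lt hv1⟩

/-! ### The inclusion -/

/-- Sites of the core off the black run are white under the paint. [folklore] -/
theorem not_mem_of_paint {ω : SiteConfig (Site 2)} (hpaint : ω ∈ paint (coreOf (sOf m i) m) (blackRun m i))
    {v : Site 2} (hv : triNorm v ≤ m) (hs : ∀ j, v ≠ sOf m i j) (hb : v ∉ blackRun m i) : v ∉ ω := by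
  classical
  have hcore : v ∈ coreOf (sOf m i) m := by
    rw [coreOf, Finset.mem_sdiff, mem_triBall_iff]
    refine ⟨hv, fun hmem => ?_⟩
    obtain ⟨j, -, hj⟩ := Finset.mem_image.1 hmem
    exact hs j hj.symm
  exact fun hω => hb ((hpaint v hcore).1 hω)

section Main

variable (h : GadgetIdx m i)
include h

/-- Sites of the black run are black under the paint. [folklore] -/
theorem GadgetIdx.mem_of_paint {ω : SiteConfig (Site 2)} (hpaint : ω ∈ paint (coreOf (sOf m i) m) (blackRun m i))
    {v : Site 2} (hv : v ∈ blackRun m i) : v ∈ ω := by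
  classical
  obtain ⟨j, hj1, hj2, rfl⟩ := hv
  have hm := h.four_le
  have hcore : rp (m - 1) j ∈ coreOf (sOf m i) m := by
    rw [coreOf, Finset.mem_sdiff, mem_triBall_iff, h.triNorm_rp_m1]
    refine ⟨by omega, fun hmem => ?_⟩
    obtain ⟨j', -, hj'⟩ := Finset.mem_image.1 hmem
    have e := congrArg triNorm hj'
    rw [sOf, h.triNorm_rp_m, h.triNorm_rp_m1] at e
    omega
  exact (hpaint _ hcore).2 ⟨j, hj1, hj2, rfl⟩

/-- Ring-`m` sites of indices strictly inside the turn after `i₀`, off the landing indices, are not landing sites. [folklore] -/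
theorem GadgetIdx.rp_m_ne_sOf {j : ℕ} (hj : i 0 < j) (hj' : j < i 0 + 6 * m) (hne : ∀ l, j ≠ i l) (l : Fin 5) : rp m j ≠ sOf m i l := by
  have hb := h.i_bounds l
  show rp m j ≠ rp m (i l)
  rcases lt_or_gt_of_ne (hne l) with hlt | hgt
  · exact h.rp_m_ne (le_of_lt hj) hlt hb.2
  · exact (h.rp_m_ne hb.1 hgt hj').symm

end Main

/-- The escape set through `s₀⁺`: the arc of `∂Λ_m` and the arm of `s₁` (its part `T`). [folklore] -/
def escA (m : ℕ) (i : Fin 5 → ℕ) (T : Set (Site 2)) : Set (Site 2) := aArc m i ∪ T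

/-- The escape set through `p`: `p`, the backward arc of `∂Λ_m` and the arm of `s₄`. [folklore] -/
def escB (m : ℕ) (i : Fin 5 → ℕ) (T : Set (Site 2)) : Set (Site 2) := ({p m i} ∪ bArc m i) ∪ T

/-- The escape set through `r`: `r, r₂`, the white run of `∂Λ_{m-1}` and the arm of `s₃`. [folklore] -/
def escC (m : ℕ) (i : Fin 5 → ℕ) (T : Set (Site 2)) : Set (Site 2) := ({r m i, r₂ m i} ∪ whiteRun m i) ∪ T

/-- Pairwise disjointness of a triple of sets from the three disjointness relations. [folklore] -/
theorem pairwise_disjoint_three {α : Type*} {A B C : Set α} (hAB : Disjoint A B) (hAC : Disjoint A C) (hBC : Disjoint B C) :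
    Pairwise fun a b => Disjoint (![A, B, C] a) (![A, B, C] b) := by
  intro a b hab
  fin_cases a <;> fin_cases b <;> simp at hab ⊢ <;>
    first | exact hAB | exact hAC | exact hBC | exact hAB.symm | exact hAC.symm | exact hBC.symm

/-- `R + 1` as an integer bound. [folklore] -/
theorem setOf_triNorm_le_succ (R : ℕ) : {v : Site 2 | triNorm v ≤ ((R + 1 : ℕ) : ℤ)} = {v | triNorm v ≤ (R : ℤ) + 1} := by
  ext v; push_cast; exact Iff.rfl

section Main2

variable (h : GadgetIdx m i)
include h

/-- **The inclusion.** For indices `GadgetIdx m i`, radii `m + 1 ≤ R`, `R + 1 ≤ n`, every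
configuration with plain arms of colours `B, W, B, W, W` from the landing tuple `(rp m (i j))_j`
whose core `Λ_m ∖ {landing sites}` is painted black exactly on the black run satisfies the kissing
certificate at `x⋆` inside `Λ_R`. [cite: WernerPCMI2009, First exercise sheet, "Five-arm exponent", 2) a) (arXiv 0710.0856)] -/
theorem GadgetIdx.mem_kissCert {R n : ℕ} (hR : m + 1 ≤ R) (hRn : R + 1 ≤ n) {ω : SiteConfig (Site 2)}
    (hω : ω ∈ plainArms κE (sOf m i) m n) (hpaint : ω ∈ paint (coreOf (sOf m i) m) (blackRun m i)) :
    ω ∈ kissCert (xs m i) R := by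
  classical
  have hm := h.four_le; have hbase := h.base
  have h01 := h.lt01; have h12 := h.lt12; have h23 := h.lt23; have h34 := h.lt34; have h40 := h.lt40
  have hXfB := h.X_lt_fB; have hfBfW := h.fB_lt_fW; have hfWub := h.fW_le_ub; have hub := h.ub_add_two
  have nM := h.triNorm_rp_m; have nM1 := h.triNorm_rp_m1; have nM2 := h.triNorm_rp_m2
  have nxs : triNorm (xs m i) = (m : ℤ) - 1 := nM1 _
  have nv : ∀ {u v : Site 2}, triNorm u ≠ triNorm v → u ≠ v := fun hne e => hne (congrArg triNorm e)
  obtain ⟨y, w, hw, hdisj⟩ := hω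
  -- the arms
  have hy : ∀ j, triNorm (y j) = n := fun j => mem_triSphere_iff.1 (hw j).1
  have hsupp : ∀ j, ∀ v ∈ (w j).support, v = rp m (i j) ∨ ((m : ℤ) < triNorm v ∧ triNorm v ≤ n) := fun j => (hw j).2.2.1
  have hcol : ∀ j, ∀ v ∈ (w j).support, (v ∈ ω ↔ κE j = true) := fun j => (hw j).2.2.2
  have hge : ∀ j, ∀ v ∈ (w j).support, (m : ℤ) ≤ triNorm v := fun j v hv => by
    rcases hsupp j v hv with e | h'
    · rw [e, nM]
    · exact le_of_lt h'.1
  have hat : ∀ j, ∀ v ∈ (w j).support, triNorm v = m → v = rp m (i j) := fun j v hv hn => by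
    rcases hsupp j v hv with e | h'
    · exact e
    · omega
  have harm : ∀ j, PathIn triGraph {v | v ∈ (w j).support} (rp m (i j)) (y j) := fun j => PathIn.of_walk (w j) fun v hv => hv
  have hdj : ∀ {j k : Fin 5}, j ≠ k → ∀ v, v ∈ (w j).support → v ∉ (w k).support := fun hjk v hv hv' =>
    Finset.disjoint_left.1 (hdisj hjk) (List.mem_toFinset.2 hv) (List.mem_toFinset.2 hv')
  have hstart : ∀ j, rp m (i j) ∈ (w j).support := fun j => (w j).start_mem_support
  -- colours in the core
  have W : ∀ v, triNorm v ≤ m → (∀ l, v ≠ sOf m i l) → v ∉ blackRun m i → v ∉ ω := fun v hv hs hb =>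
    not_mem_of_paint hpaint hv hs hb
  have B : ∀ v ∈ blackRun m i, v ∈ ω := fun v hv => h.mem_of_paint hpaint hv
  have nBlack : ∀ v ∈ blackRun m i, triNorm v = (m : ℤ) - 1 := by rintro v ⟨j, -, -, rfl⟩; exact nM1 j
  have nsOf : ∀ l, triNorm (sOf m i l) = m := fun l => nM _
  -- (1) `x⋆` is white
  have hxs : xs m i ∉ ω := by
    refine W _ (by rw [nxs]; omega) (fun l => nv (by rw [nxs, nsOf]; omega)) ?_
    rintro ⟨j, hj1, hj2, hj⟩
    exact h.rp_m1_ne le_rfl (by omega) (by omega) hj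
  -- (2) the five neighbours and their directions
  have axb : triGraph.Adj (xs m i) (rp m (i 0)) := h.adj_b_xs.symm
  have axbp : triGraph.Adj (xs m i) (rp m (i 0 + 1)) := h.adj_bp_xs.symm
  have axq : triGraph.Adj (xs m i) (q m i) := h.adj_xs_q
  have axp : triGraph.Adj (xs m i) (p m i) := h.adj_p_xs.symm
  have axr : triGraph.Adj (xs m i) (r m i) := h.adj_xs_r
  have eb := eq_add_triDir_dirOf axb
  have ebp := eq_add_triDir_dirOf axbp
  have eq' := eq_add_triDir_dirOf axq
  have ep := eq_add_triDir_dirOf axp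
  have er := eq_add_triDir_dirOf axr
  have nq : triNorm (q m i) = (m : ℤ) - 1 := nM1 _
  have np : triNorm (p m i) = (m : ℤ) - 1 := nM1 _
  have nr : triNorm (r m i) = (m : ℤ) - 2 := nM2 _
  have b_bp : rp m (i 0) ≠ rp m (i 0 + 1) := h.rp_m_ne le_rfl (by omega) (by omega)
  have b_q : rp m (i 0) ≠ q m i := nv (by rw [nM, nq]; omega)
  have b_p : rp m (i 0) ≠ p m i := nv (by rw [nM, np]; omega)
  have bp_q : rp m (i 0 + 1) ≠ q m i := nv (by rw [nM, nq]; omega)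
  have bp_p : rp m (i 0 + 1) ≠ p m i := nv (by rw [nM, np]; omega)
  have q_p : q m i ≠ p m i := h.rp_m1_ne (by omega) (by omega) (by omega)
  have hfan : (((dirOf (xs m i) (rp m (i 0 + 1)) - dirOf (xs m i) (rp m (i 0)) : Fin 6) : ℕ) <
        ((dirOf (xs m i) (q m i) - dirOf (xs m i) (rp m (i 0)) : Fin 6) : ℕ) ∧
        ((dirOf (xs m i) (q m i) - dirOf (xs m i) (rp m (i 0)) : Fin 6) : ℕ) <
        ((dirOf (xs m i) (p m i) - dirOf (xs m i) (rp m (i 0)) : Fin 6) : ℕ)) ∨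
      (((dirOf (xs m i) (p m i) - dirOf (xs m i) (rp m (i 0)) : Fin 6) : ℕ) <
        ((dirOf (xs m i) (q m i) - dirOf (xs m i) (rp m (i 0)) : Fin 6) : ℕ) ∧
        ((dirOf (xs m i) (q m i) - dirOf (xs m i) (rp m (i 0)) : Fin 6) : ℕ) <
        ((dirOf (xs m i) (rp m (i 0 + 1)) - dirOf (xs m i) (rp m (i 0)) : Fin 6) : ℕ)) := by
    by_cases hdvd : m ∣ i 0 + 1
    · -- the long chain `s₀ ∼ s₀⁺ ∼ s₀⁺⁺ ∼ q`
      have axc : triGraph.Adj (xs m i) (rp m (i 0 + 2)) := (h.adj_bpp_xs hdvd).symm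
      have c_b : rp m (i 0 + 2) ≠ rp m (i 0) := (h.rp_m_ne le_rfl (by omega) (by omega)).symm
      have c_bp : rp m (i 0 + 2) ≠ rp m (i 0 + 1) := (h.rp_m_ne (by omega) (by omega) (by omega)).symm
      have c_q : rp m (i 0 + 2) ≠ q m i := nv (by rw [nM, nq]; omega)
      have c_p : rp m (i 0 + 2) ≠ p m i := nv (by rw [nM, np]; omega)
      exact fan_of_chain3 _ _ _ _ _ (dirOf_step axb axbp h.adj_b_bp) (dirOf_step axbp axc (rp_adj h.one_le _))
        (dirOf_step axc axq (h.adj_bpp_q hdvd)) (dirOf_ne_of_ne axc axb c_b) (dirOf_ne_of_ne axq axbp bp_q.symm)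
        (dirOf_ne_of_ne axq axb b_q.symm) (dirOf_ne_of_ne axp axb b_p.symm) (dirOf_ne_of_ne axp axbp bp_p.symm)
        (dirOf_ne_of_ne axp axc c_p.symm) (dirOf_ne_of_ne axp axq q_p.symm)
    · exact fan_of_chain2 _ _ _ _ (dirOf_step axb axbp h.adj_b_bp) (dirOf_step axbp axq (h.adj_bp_q hdvd))
        (dirOf_ne_of_ne axq axb b_q.symm) (dirOf_ne_of_ne axp axb b_p.symm) (dirOf_ne_of_ne axp axbp bp_p.symm)
        (dirOf_ne_of_ne axp axq q_p.symm)
  -- (3) the black paths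
  have P0 : ∃ t, triNorm t = R ∧ PathIn triGraph {v | v ∈ ω ∧ triNorm v ≤ R} (xs m i + triDir (dirOf (xs m i) (rp m (i 0)))) t := by
    rw [← eb]
    have p0 : PathIn triGraph {v | v ∈ ω} (rp m (i 0)) (y 0) := (harm 0).mono fun v hv => (hcol 0 v hv).2 rfl
    exact exists_pathIn_trunc p0 (by rw [nM]; omega) (by rw [hy]; omega)
  have P2 : ∃ t, triNorm t = R ∧ PathIn triGraph {v | v ∈ ω ∧ triNorm v ≤ R}
      (xs m i + triDir (dirOf (xs m i) (rp m (i 0)) + (dirOf (xs m i) (q m i) - dirOf (xs m i) (rp m (i 0))))) t := by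
    rw [add_sub_cancel, ← eq']
    have prun : PathIn triGraph {v | v ∈ ω} (q m i) (rp (m - 1) (fB m i)) :=
      pathIn_rp_run h.one_le' hXfB fun j hj1 hj2 => B _ ⟨j, hj1, hj2, rfl⟩
    have hs2 : rp m (i 2) ∈ {v : Site 2 | v ∈ ω} := (hcol 2 _ (hstart 2)).2 rfl
    have p2 : PathIn triGraph {v | v ∈ ω} (q m i) (y 2) :=
      (prun.tail h.adj_s2_fB.symm hs2).trans ((harm 2).mono fun v hv => (hcol 2 v hv).2 rfl)
    exact exists_pathIn_trunc p2 (by rw [nq]; omega) (by rw [hy]; omega)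
  -- (4) the white escapes: truncated white arms
  have trW : ∀ j, ∃ f, triNorm f = R + 1 ∧ PathIn triGraph {v | v ∈ (w j).support ∧ triNorm v ≤ R + 1} (rp m (i j)) f := by
    intro j
    obtain ⟨f, hf, pf⟩ := exists_pathIn_trunc (R := R + 1) (harm j) (by rw [nM]; omega) (by rw [hy]; omega)
    refine ⟨f, by rw [hf]; push_cast; ring, ?_⟩
    have e : ({v : Site 2 | v ∈ (w j).support} ∩ {v | triNorm v ≤ ((R + 1 : ℕ) : ℤ)}) =
        {v | v ∈ (w j).support ∧ triNorm v ≤ (R : ℤ) + 1} := by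
      rw [setOf_triNorm_le_succ]; rfl
    rwa [e] at pf
  -- the arm parts of the escape sets
  have TA := trW 1
  have TB := trW 4
  have TC := trW 3
  -- escape A: `s₀⁺`, the arc, `s₁`, arm 1
  have EA : ∃ f, triNorm f = R + 1 ∧ PathIn triGraph (escA m i {v | v ∈ (w 1).support ∧ triNorm v ≤ R + 1}) (rp m (i 0 + 1)) f := by
    obtain ⟨f, hf, pf⟩ := TA
    refine ⟨f, hf, (pathIn_rp_run h.one_le (show i 0 + 1 ≤ i 1 by omega) fun j hj1 hj2 => ?_).trans (pf.mono Set.subset_union_right)⟩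
    rcases Nat.lt_or_ge j (i 1) with hlt | hge'
    · exact Or.inl ⟨j, by omega, hlt, rfl⟩
    · obtain rfl : j = i 1 := by omega
      exact Or.inr ⟨hstart 1, by rw [nM]; omega⟩
  -- escape B: `p`, `s₀⁻`, the backward arc, `s₄`, arm 4
  have EB : ∃ f, triNorm f = R + 1 ∧ PathIn triGraph (escB m i {v | v ∈ (w 4).support ∧ triNorm v ≤ R + 1}) (p m i) f := by
    obtain ⟨f, hf, pf⟩ := TB
    have hmemB : ∀ j, i 4 ≤ j → j ≤ i 0 + 6 * m - 1 → rp m j ∈ escB m i {v | v ∈ (w 4).support ∧ triNorm v ≤ R + 1} := by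
      intro j hj1 hj2
      rcases Nat.lt_or_ge (i 4) j with hlt | hge'
      · exact Or.inl (Or.inr ⟨j, hlt, by omega, rfl⟩)
      · obtain rfl : j = i 4 := by omega
        exact Or.inr ⟨hstart 4, by rw [nM]; omega⟩
    have prun := pathIn_rp_run' h.one_le (show i 4 ≤ i 0 + 6 * m - 1 by omega) hmemB
    have hp : p m i ∈ escB m i {v | v ∈ (w 4).support ∧ triNorm v ≤ R + 1} := Or.inl (Or.inl (Set.mem_singleton _))
    exact ⟨f, hf, ((PathIn.of_adj hp (hmemB _ (by omega) le_rfl) h.adj_bm_p.symm).trans prun).trans (pf.mono Set.subset_union_right)⟩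
  -- escape C: `r`, `r₂`, the white run backwards, `s₃`, arm 3
  have EC : ∃ f, triNorm f = R + 1 ∧ PathIn triGraph (escC m i {v | v ∈ (w 3).support ∧ triNorm v ≤ R + 1}) (r m i) f := by
    obtain ⟨f, hf, pf⟩ := TC
    have hmemC : ∀ j, fW m i ≤ j → j ≤ ub m i → rp (m - 1) j ∈ escC m i {v | v ∈ (w 3).support ∧ triNorm v ≤ R + 1} :=
      fun j hj1 hj2 => Or.inl (Or.inr ⟨j, hj1, hj2, rfl⟩)
    have prun := pathIn_rp_run' h.one_le' hfWub hmemC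
    have hr : r m i ∈ escC m i {v | v ∈ (w 3).support ∧ triNorm v ≤ R + 1} := Or.inl (Or.inl (Set.mem_insert _ _))
    have hr₂ : r₂ m i ∈ escC m i {v | v ∈ (w 3).support ∧ triNorm v ≤ R + 1} :=
      Or.inl (Or.inl (Set.mem_insert_of_mem _ (Set.mem_singleton _)))
    have p1 : PathIn triGraph (escC m i {v | v ∈ (w 3).support ∧ triNorm v ≤ R + 1}) (r m i) (r₂ m i) :=
      PathIn.of_eq_or_adj hr hr₂ h.r_eq_or_adj
    have p2 := PathIn.of_adj hr₂ (hmemC _ hfWub le_rfl) h.adj_e_r₂.symm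
    have p3 := PathIn.of_adj (hmemC _ le_rfl hfWub) (show rp m (i 3) ∈ escC m i {v | v ∈ (w 3).support ∧ triNorm v ≤ R + 1} from
      Or.inr ⟨hstart 3, by rw [nM]; omega⟩) h.adj_s3_fW.symm
    exact ⟨f, hf, (((p1.trans p2).trans prun).trans p3).trans (pf.mono Set.subset_union_right)⟩
  -- (5) the escape sets are white, avoid `x⋆`, stay in `Λ_{R+1}`
  have armT : ∀ j, κE j = false → {v : Site 2 | v ∈ (w j).support ∧ triNorm v ≤ R + 1} ⊆ {v | v ∉ ω ∧ v ≠ xs m i ∧ triNorm v ≤ R + 1} := by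
    rintro j hj v ⟨hv, hvR⟩
    refine ⟨fun hω => ?_, nv (by have := hge j v hv; rw [nxs]; omega), hvR⟩
    have := (hcol j v hv).1 hω
    rw [hj] at this
    exact Bool.false_ne_true this
  have ringT : ∀ j, i 0 < j → j < i 0 + 6 * m → (∀ l, j ≠ i l) → rp m j ∈ {v : Site 2 | v ∉ ω ∧ v ≠ xs m i ∧ triNorm v ≤ R + 1} :=
    fun j hj hj' hne => ⟨W _ (by rw [nM]) (h.rp_m_ne_sOf hj hj' hne) (fun hb => by have := nBlack _ hb; rw [nM] at this; omega),
      nv (by rw [nM, nxs]; omega), by rw [nM]; omega⟩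
  have hSA : escA m i {v | v ∈ (w 1).support ∧ triNorm v ≤ R + 1} ⊆ {v | v ∉ ω ∧ v ≠ xs m i ∧ triNorm v ≤ R + 1} := by
    rintro v (⟨j, hj1, hj2, rfl⟩ | hv)
    · exact ringT j hj1 (by omega) (fun l => by have := h.i_bounds l; fin_cases l <;> simp <;> omega)
    · exact armT 1 rfl hv
  have hp_white : p m i ∈ {v : Site 2 | v ∉ ω ∧ v ≠ xs m i ∧ triNorm v ≤ R + 1} := by
    refine ⟨W _ (by rw [np]; omega) (fun l => nv (by rw [np, nsOf]; omega)) ?_, ?_, by rw [np]; omega⟩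
    · rintro ⟨j, hj1, hj2, hj⟩
      exact h.rp_m1_ne (by omega) (show j < X m i + 6 * (m - 1) - 1 by omega) (by omega) hj.symm
    · -- `p ≠ x⋆` by index, not by norm
      intro e
      refine rp_ne_rp_of_lt h.one_le' (show X m i + 6 * (m - 1) - 1 < X m i + 6 * (m - 1) by omega) (by omega) ?_
      rw [← xs_eq_turn]; exact e
  have hSB : escB m i {v | v ∈ (w 4).support ∧ triNorm v ≤ R + 1} ⊆ {v | v ∉ ω ∧ v ≠ xs m i ∧ triNorm v ≤ R + 1} := by
    rintro v ((hv | ⟨j, hj1, hj2, rfl⟩) | hv)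
    · rw [Set.mem_singleton_iff] at hv; rw [hv]; exact hp_white
    · exact ringT j (by omega) hj2 (fun l => by have := h.i_bounds l; fin_cases l <;> simp <;> omega)
    · exact armT 4 rfl hv
  have whiteT : ∀ j, fW m i ≤ j → j ≤ ub m i → rp (m - 1) j ∈ {v : Site 2 | v ∉ ω ∧ v ≠ xs m i ∧ triNorm v ≤ R + 1} := by
    intro j hj1 hj2
    refine ⟨W _ (by rw [nM1]; omega) (fun l => nv (by rw [nM1, nsOf]; omega)) ?_, ?_, by rw [nM1]; omega⟩
    · rintro ⟨j', hj'1, hj'2, hj'⟩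
      exact h.rp_m1_ne (by omega) (show j' < j by omega) (by omega) hj'.symm
    · exact (h.rp_m1_ne le_rfl (show X m i < j by omega) (by omega)).symm
  have hSC : escC m i {v | v ∈ (w 3).support ∧ triNorm v ≤ R + 1} ⊆ {v | v ∉ ω ∧ v ≠ xs m i ∧ triNorm v ≤ R + 1} := by
    rintro v ((hv | ⟨j, hj1, hj2, rfl⟩) | hv)
    · have hv' : v = r m i ∨ v = r₂ m i := by simpa using hv
      have hn : triNorm v = (m : ℤ) - 2 := by rcases hv' with rfl | rfl <;> exact nM2 _
      exact ⟨W _ (by rw [hn]; omega) (fun l => nv (by rw [hn, nsOf]; omega)) (fun hb => by have := nBlack _ hb; omega),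
        nv (by rw [hn, nxs]; omega), by rw [hn]; omega⟩
    · exact whiteT j hj1 hj2
    · exact armT 3 rfl hv
  -- (6) the escape sets are pairwise disjoint
  have armR : ∀ {j : Fin 5} {v : Site 2}, v ∈ (w j).support → ∀ {a : ℕ}, v = rp m a → i 0 ≤ a → a < i 0 + 6 * m → a = i j := by
    intro j v hv a hva ha1 ha2
    have hn : triNorm v = m := by rw [hva, nM]
    have e := hat j v hv hn
    rw [hva] at e
    by_contra hne
    have hb := h.i_bounds j
    rcases lt_or_gt_of_ne hne with hlt | hgt
    · exact h.rp_m_ne ha1 hlt hb.2 e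
    · exact h.rp_m_ne hb.1 hgt ha2 e.symm
  have hAB : Disjoint (escA m i {v | v ∈ (w 1).support ∧ triNorm v ≤ R + 1}) (escB m i {v | v ∈ (w 4).support ∧ triNorm v ≤ R + 1}) := by
    refine Set.disjoint_left.2 ?_
    rintro v (⟨j, hj1, hj2, rfl⟩ | ⟨hv, -⟩) ((hv' | ⟨j', hj'1, hj'2, hv'⟩) | ⟨hv', -⟩)
    · rw [Set.mem_singleton_iff] at hv'; exact nv (by rw [nM, np]; omega) hv'
    · exact h.rp_m_ne (by omega) (show j < j' by omega) hj'2 hv'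
    · have := armR hv' rfl (by omega) (by omega); omega
    · rw [Set.mem_singleton_iff] at hv'; exact nv (by have := hge 1 v hv; rw [np]; omega) hv'
    · have := armR hv hv' (by omega) hj'2; omega
    · exact hdj (by decide) v hv hv'
  have hAC : Disjoint (escA m i {v | v ∈ (w 1).support ∧ triNorm v ≤ R + 1}) (escC m i {v | v ∈ (w 3).support ∧ triNorm v ≤ R + 1}) := by
    refine Set.disjoint_left.2 ?_
    rintro v (⟨j, hj1, hj2, rfl⟩ | ⟨hv, -⟩) ((hv' | ⟨j', hj'1, hj'2, hv'⟩) | ⟨hv', -⟩)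
    · have hv'' : rp m j = r m i ∨ rp m j = r₂ m i := by simpa using hv'
      rcases hv'' with e | e
      · exact nv (by rw [nM, nr]; omega) e
      · exact nv (by rw [nM]; show (m : ℤ) ≠ triNorm (rp (m - 2) _); rw [nM2]; omega) e
    · exact nv (by rw [nM, nM1]; omega) hv'
    · have := armR hv' rfl (by omega) (by omega); omega
    · have hv'' : v = r m i ∨ v = r₂ m i := by simpa using hv'
      have h1 := hge 1 v hv
      rcases hv'' with e | e
      · exact nv (by rw [nr]; omega) e
      · exact nv (by show triNorm v ≠ triNorm (rp (m - 2) _); rw [nM2]; omega) e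
    · exact nv (by have := hge 1 v hv; rw [nM1]; omega) hv'
    · exact hdj (by decide) v hv hv'
  have hBC : Disjoint (escB m i {v | v ∈ (w 4).support ∧ triNorm v ≤ R + 1}) (escC m i {v | v ∈ (w 3).support ∧ triNorm v ≤ R + 1}) := by
    refine Set.disjoint_left.2 ?_
    rintro v ((hv | ⟨j, hj1, hj2, rfl⟩) | ⟨hv, -⟩) ((hv' | ⟨j', hj'1, hj'2, hv'⟩) | ⟨hv', -⟩)
    · rw [Set.mem_singleton_iff] at hv; subst hv
      have hv'' : p m i = r m i ∨ p m i = r₂ m i := by simpa using hv'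
      rcases hv'' with e | e
      · exact nv (by rw [np, nr]; omega) e
      · exact nv (by rw [np]; show (m : ℤ) - 1 ≠ triNorm (rp (m - 2) _); rw [nM2]; omega) e
    · rw [Set.mem_singleton_iff] at hv; subst hv
      exact h.rp_m1_ne (by omega) (show j' < X m i + 6 * (m - 1) - 1 by omega) (by omega) hv'.symm
    · rw [Set.mem_singleton_iff] at hv; subst hv
      exact nv (by have := hge 3 _ hv'; rw [np]; omega) rfl
    · have hv'' : rp m j = r m i ∨ rp m j = r₂ m i := by simpa using hv'
      rcases hv'' with e | e
      · exact nv (by rw [nM, nr]; omega) e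
      · exact nv (by rw [nM]; show (m : ℤ) ≠ triNorm (rp (m - 2) _); rw [nM2]; omega) e
    · exact nv (by rw [nM, nM1]; omega) hv'
    · have := armR hv' rfl (by omega) hj2; omega
    · have hv'' : v = r m i ∨ v = r₂ m i := by simpa using hv'
      have h1 := hge 4 v hv
      rcases hv'' with e | e
      · exact nv (by rw [nr]; omega) e
      · exact nv (by show triNorm v ≠ triNorm (rp (m - 2) _); rw [nM2]; omega) e
    · exact nv (by have := hge 4 v hv; rw [nM1]; omega) hv'
    · exact hdj (by decide) v hv hv'
  -- (7) assembly
  have EA' : ∃ f, triNorm f = R + 1 ∧ PathIn triGraph (escA m i {v | v ∈ (w 1).support ∧ triNorm v ≤ R + 1})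
      (xs m i + triDir (dirOf (xs m i) (rp m (i 0 + 1)))) f := by rw [← ebp]; exact EA
  have EB' : ∃ f, triNorm f = R + 1 ∧ PathIn triGraph (escB m i {v | v ∈ (w 4).support ∧ triNorm v ≤ R + 1})
      (xs m i + triDir (dirOf (xs m i) (p m i))) f := by rw [← ep]; exact EB
  have EC' : ∃ f, triNorm f = R + 1 ∧ PathIn triGraph (escC m i {v | v ∈ (w 3).support ∧ triNorm v ≤ R + 1})
      (xs m i + triDir (dirOf (xs m i) (r m i))) f := by rw [← er]; exact EC
  have hδ : dirOf (xs m i) (q m i) - dirOf (xs m i) (rp m (i 0)) ≠ 0 := sub_ne_zero.2 (dirOf_ne_of_ne axq axb b_q.symm)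
  rcases hfan with ⟨hk0, hk1⟩ | ⟨hk0, hk1⟩
  · refine ⟨hxs, _, _, ![dirOf (xs m i) (rp m (i 0 + 1)), dirOf (xs m i) (p m i), dirOf (xs m i) (r m i)], hδ, hk0, hk1, P0, P2,
      ![escA m i {v | v ∈ (w 1).support ∧ triNorm v ≤ R + 1}, escB m i {v | v ∈ (w 4).support ∧ triNorm v ≤ R + 1},
        escC m i {v | v ∈ (w 3).support ∧ triNorm v ≤ R + 1}], ?_, pairwise_disjoint_three hAB hAC hBC, ?_⟩
    · intro l; fin_cases l; exacts [hSA, hSB, hSC]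
    · intro l; fin_cases l; exacts [EA', EB', EC']
  · refine ⟨hxs, _, _, ![dirOf (xs m i) (p m i), dirOf (xs m i) (rp m (i 0 + 1)), dirOf (xs m i) (r m i)], hδ, hk0, hk1, P0, P2,
      ![escB m i {v | v ∈ (w 4).support ∧ triNorm v ≤ R + 1}, escA m i {v | v ∈ (w 1).support ∧ triNorm v ≤ R + 1},
        escC m i {v | v ∈ (w 3).support ∧ triNorm v ≤ R + 1}], ?_, pairwise_disjoint_three hAB.symm hBC hAC, ?_⟩
    · intro l; fin_cases l; exacts [hSB, hSA, hSC]
    · intro l; fin_cases l; exacts [EB', EA', EC']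

end Main2

end Gadget

end Literature.Probability.Percolation

end
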